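import Summits.QuantumFields.YangMills.Theorems.FlatTubeReductionPinnedUnitStepExOneStepDoor
import Summits.QuantumFields.YangMills.Theorems.FlatTubeReductionPinnedUnitStepExZeroMomentum
import HarnessLib

/-!
# Route `FlatTubeReduction`, crux `PinnedUnitStepEx` (stmt-QuantumFields-27561) — the SPLIT DOOR of stub 2 (`stub_pinnedAutocorrExTI1`)

Seat leafhand-qf-flattubereduction-1 g0 (2026-08-30).  Registered skeleton «ti-split-1» v2 (planner ym-idea-1 g6; stub Props in
`Theorems/FlatTubeReductionPinnedUnitStepExDefs.lean`; stub 1 LANDED p642758).  The remaining stub `PinnedAutocorrExTI1` is an `∃φ′`-statement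
that fuses two claims of different nature:

* (P1) EXISTENCE — along the femto window the first zero-flux excitation of the coarse transfer operator has a ZERO-MOMENTUM member
  (a translation-invariant normalised physical `φ′ ⊥ Ω′` with `K_{β′}φ′ = λ₁′φ′`);
* (P2) COMPARISON — the one-slab two-cutoff autocorrelation bound for the smeared trial `ψ = fbar·Ω` of such a `φ′` (budget `e^{CΛ²/L′}`).

`pinnedAutocorrExTI1_of_separation_of_oneStep` proves the stub from the two claims in their weakest natural INDEPENDENT shapes:

* `hP1` — for every small level `lam` and every sufficiently fine `L′`, at every window coupling `β′` and for the item's coarse ground state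
  `Ω′`, the VARIATIONAL SEPARATION of `ZeroMomentum.exists_ti_secondEigen_of_separation`: some translation-invariant physical `ψ₀ ⊥ Ω′` has a
  Rayleigh quotient strictly above that of every zero-average (non-zero-momentum) physical `ψ ⊥ Ω′` (Lüscher's picture: non-zero momenta cost
  `O(2π)/L′`, the zero-momentum excitation only `ε₁λ/L′`);
* `hP2` — the ONE-STEP comparison of the one-step door (p644937) for EVERY translation-invariant normalised `secondValue′`-eigenfunction
  `φ′ ⊥ Ω′` (universally quantified, so that the supplier of (P2) need not know which member (P1) produces).

Constants: `C` from `hP2`, `lam0 = min lam1 lam2`, `L0 = max L1 L2`.  HONEST FRAMING: a door only; neither `hP1` nor `hP2` is proved here or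
anywhere in the tree ((P2) is the XL two-cutoff wall, class `Literature.Barriers.QuantumFields.UVStabilityNonUniqueness`); R2b1 is a RECORD rung;
no stub, crux or summit is proved by this file.
References: M. Reed, B. Simon IV (1978) Thm XIII.1; M. Lüscher, Nucl. Phys. B219 (1983) §3.
-/

set_option autoImplicit false

noncomputable section

namespace Summit.QuantumFields.YangMills.Cruxes.PinnedUnitStepEx.TISplit1

open MeasureTheory
open Literature.MathematicalPhysics.QuantumFieldTheory (Site Edge GaugeConfig gaugeTransform)
open Summit.QuantumFields.YangMills.Theorems.FemtoTransferGap
open Summit.QuantumFields.YangMills.Theorems.FlatTubeReduction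

/-- ★★ **SPLIT DOOR of stub 2** (`stub_pinnedAutocorrExTI1`): (P1) as a per-lattice variational separation along the window (`hP1`) and (P2) as
the one-step comparison for every translation-invariant normalised coarse `secondValue′`-eigenfunction (`hP2`) together give the registered
stub `PinnedAutocorrExTI1` (via `ZeroMomentum.exists_ti_secondEigen_of_separation_inline` and `pinnedAutocorrExTI1_of_oneStep`).
[cite: ReedSimonIV1978, Thm. XIII.1] [cite: Luscher1983, §3] -/
theorem pinnedAutocorrExTI1_of_separation_of_oneStep
    (hP1 : ∃ lam1 : ℝ, 0 < lam1 ∧ ∀ lam : ℝ, 0 < lam → lam ≤ lam1 → ∃ L1 : ℕ, ∀ (L' : ℕ) [NeZero L'], L1 ≤ L' → ∀ β' : ℝ,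
      InFemtoWindow lam β' L' →
      ∀ Ω' : GaugeConfig 3 L' SU2 → ℝ, IsPhys Ω' → ∀ c' : ℝ, 0 < c' → (∀ U', c' ≤ Ω' U') → l2 Ω' Ω' = 1 →
      (∀ U', ∫ V', transferKernel su2Rep β' U' V' * Ω' V' ∂(configMeasure SU2 L') = topValue su2Rep L' β' * Ω' U') →
      ∃ ψ₀ : GaugeConfig 3 L' SU2 → ℝ, IsPhys ψ₀ ∧
        (∀ (v' : Site 3 L') (U' : GaugeConfig 3 L' SU2), ψ₀ (fun e => U' (e.1 - v', e.2)) = ψ₀ U') ∧ l2 ψ₀ Ω' = 0 ∧ 0 < l2 ψ₀ ψ₀ ∧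
        ∀ ψ : GaugeConfig 3 L' SU2 → ℝ, IsPhys ψ →
          (∀ U' : GaugeConfig 3 L' SU2,
            (Fintype.card (Site 3 L') : ℝ)⁻¹ * ∑ v' : Site 3 L', ψ (fun e => U' (e.1 - v', e.2)) = 0) →
          l2 ψ Ω' = 0 → 0 < l2 ψ ψ → qform su2Rep β' ψ ψ * l2 ψ₀ ψ₀ < qform su2Rep β' ψ₀ ψ₀ * l2 ψ ψ)
    (hP2 : ∃ C lam2 : ℝ, 0 < lam2 ∧ ∀ lam : ℝ, 0 < lam → lam ≤ lam2 → ∃ L2 : ℕ, ∀ (L' : ℕ) [NeZero L'], L2 ≤ L' → ∀ β β' : ℝ,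
      InFemtoWindow lam β (L' + 1) → InFemtoWindow lam β' L' → luscherLambda β (L' + 1) = luscherLambda β' L' →
      ∀ Ω : GaugeConfig 3 (L' + 1) SU2 → ℝ, IsPhys Ω → (∀ U, 0 < Ω U) → l2 Ω Ω = 1 →
      (∀ U, ∫ V, transferKernel su2Rep β U V * Ω V ∂(configMeasure SU2 (L' + 1)) = topValue su2Rep (L' + 1) β * Ω U) →
      ∀ Ω' : GaugeConfig 3 L' SU2 → ℝ, IsPhys Ω' → ∀ c' : ℝ, 0 < c' → (∀ U', c' ≤ Ω' U') → l2 Ω' Ω' = 1 →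
      (∀ U', ∫ V', transferKernel su2Rep β' U' V' * Ω' V' ∂(configMeasure SU2 L') = topValue su2Rep L' β' * Ω' U') →
      ∀ φ' : GaugeConfig 3 L' SU2 → ℝ, IsPhys φ' →
        (∀ (v' : Site 3 L') (U' : GaugeConfig 3 L' SU2), φ' (fun e => U' (e.1 - v', e.2)) = φ' U') →
        l2 φ' Ω' = 0 → l2 φ' φ' = 1 →
        (∀ U', ∫ V', transferKernel su2Rep β' U' V' * φ' V' ∂(configMeasure SU2 L') = secondValue su2Rep L' β' * φ' U') →
        let T : GaugeConfig 3 (L' + 1) SU2 → GaugeConfig 3 L' SU2 := fun U e' =>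
          (List.ofFn fun t : Fin (if (e'.1 e'.2).val < L' + 1 - L' then 2 else 1) =>
            U ((fun j => (((e'.1 j).val + min (e'.1 j).val (L' + 1 - L') : ℕ) : ZMod (L' + 1))) +
              Pi.single e'.2 ((t : ℕ) : ZMod (L' + 1)), e'.2)).prod
        let fbar : GaugeConfig 3 (L' + 1) SU2 → ℝ := fun U =>
          (Fintype.card (Site 3 (L' + 1)) : ℝ)⁻¹ *
            ∑ v : Site 3 (L' + 1), φ' (T fun e => U (e.1 - v, e.2)) / Ω' (T fun e => U (e.1 - v, e.2))
        let ψ : GaugeConfig 3 (L' + 1) SU2 → ℝ := fun U => fbar U * Ω U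
        let K : (GaugeConfig 3 (L' + 1) SU2 → ℝ) → (GaugeConfig 3 (L' + 1) SU2 → ℝ) := fun χ U =>
          ∫ V, transferKernel su2Rep β U V * χ V ∂(configMeasure SU2 (L' + 1))
        secondValue su2Rep L' β' ^ L' * topValue su2Rep (L' + 1) β ^ (L' + 1) * (l2 ψ ψ - l2 ψ Ω ^ 2) ^ (L' + 1) ≤
          Real.exp (C * luscherLambda β (L' + 1) ^ 2 / (L' : ℝ)) *
            (topValue su2Rep L' β' ^ L' * (l2 ψ (K ψ) - topValue su2Rep (L' + 1) β * l2 ψ Ω ^ 2) ^ (L' + 1))) :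
    PinnedAutocorrExTI1 := by
  obtain ⟨lam1, hlam1, H1⟩ := hP1
  obtain ⟨C, lam2, hlam2, H2⟩ := hP2
  refine pinnedAutocorrExTI1_of_oneStep ⟨C, min lam1 lam2, lt_min hlam1 hlam2, fun lam hl hle => ?_⟩
  obtain ⟨L1, H1'⟩ := H1 lam hl (hle.trans (min_le_left _ _))
  obtain ⟨L2, H2'⟩ := H2 lam hl (hle.trans (min_le_right _ _))
  refine ⟨max L1 L2, ?_⟩
  intro L' _ hL0 β β' hw hw' hΛ Ω hΩ hpos hn hE Ω' hΩ' c' hc' hlow hn' hE'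
  have hβ' : 0 < β' := zero_lt_one.trans_le hw'.1
  have hpos' : ∀ U', 0 < Ω' U' := fun U' => hc'.trans_le (hlow U')
  have hsep := H1' L' (le_of_max_le_left hL0) β' hw' Ω' hΩ' c' hc' hlow hn' hE'
  obtain ⟨φ', hφ', hTI, horth, hn1, hE1⟩ :=
    ZeroMomentum.exists_ti_secondEigen_of_separation_inline hβ' hΩ' hpos' hn' hE' hsep
  exact ⟨φ', hφ', hTI, horth, hn1, hE1,
    H2' L' (le_of_max_le_right hL0) β β' hw hw' hΛ Ω hΩ hpos hn hE Ω' hΩ' c' hc' hlow hn' hE' φ' hφ' hTI horth hn1 hE1⟩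

end Summit.QuantumFields.YangMills.Cruxes.PinnedUnitStepEx.TISplit1

end

/-! ## §2 (appended) The split door with (P1) in SPECTRAL-BOUND form -/

noncomputable section

namespace Summit.QuantumFields.YangMills.Cruxes.PinnedUnitStepEx.TISplit1

open MeasureTheory
open Literature.MathematicalPhysics.QuantumFieldTheory (Site Edge GaugeConfig gaugeTransform)
open Summit.QuantumFields.YangMills.Theorems.FemtoTransferGap
open Summit.QuantumFields.YangMills.Theorems.FlatTubeReduction

/-- ★★ **SPLIT DOOR of stub 2, spectral-bound form of (P1).**  `hP1` now asks, along the window and for the item's coarse ground state `Ω′`,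
for a number `θ < λ₁′ = secondValue su2Rep L′ β′` bounding the transfer form of every physical `ψ ⊥ Ω′` with identically vanishing translation
average (`⟨ψ,K_{β′}ψ⟩ ≤ θ‖ψ‖²`: the non-zero-momentum zero-flux states lie strictly below the first excitation — Lüscher's `O(2π)/L′` versus
`ε₁λ/L′`); `hP2` is the one-step comparison for every translation-invariant normalised `secondValue′`-eigenfunction `φ′ ⊥ Ω′` as in
`pinnedAutocorrExTI1_of_separation_of_oneStep`.  Together they give `PinnedAutocorrExTI1`
(`ZeroMomentum.exists_ti_secondEigen_of_zeroAvg_bound_inline` + `pinnedAutocorrExTI1_of_oneStep`).  Door only; nothing here proves `hP1` or `hP2`.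
[cite: ReedSimonIV1978, Thm. XIII.1] [cite: Luscher1983, §3] -/
theorem pinnedAutocorrExTI1_of_zeroAvgBound_of_oneStep
    (hP1 : ∃ lam1 : ℝ, 0 < lam1 ∧ ∀ lam : ℝ, 0 < lam → lam ≤ lam1 → ∃ L1 : ℕ, ∀ (L' : ℕ) [NeZero L'], L1 ≤ L' → ∀ β' : ℝ,
      InFemtoWindow lam β' L' →
      ∀ Ω' : GaugeConfig 3 L' SU2 → ℝ, IsPhys Ω' → ∀ c' : ℝ, 0 < c' → (∀ U', c' ≤ Ω' U') → l2 Ω' Ω' = 1 →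
      (∀ U', ∫ V', transferKernel su2Rep β' U' V' * Ω' V' ∂(configMeasure SU2 L') = topValue su2Rep L' β' * Ω' U') →
      ∃ θ : ℝ, θ < secondValue su2Rep L' β' ∧
        ∀ ψ : GaugeConfig 3 L' SU2 → ℝ, IsPhys ψ →
          (∀ U' : GaugeConfig 3 L' SU2,
            (Fintype.card (Site 3 L') : ℝ)⁻¹ * ∑ v' : Site 3 L', ψ (fun e => U' (e.1 - v', e.2)) = 0) →
          l2 ψ Ω' = 0 → qform su2Rep β' ψ ψ ≤ θ * l2 ψ ψ)
    (hP2 : ∃ C lam2 : ℝ, 0 < lam2 ∧ ∀ lam : ℝ, 0 < lam → lam ≤ lam2 → ∃ L2 : ℕ, ∀ (L' : ℕ) [NeZero L'], L2 ≤ L' → ∀ β β' : ℝ,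
      InFemtoWindow lam β (L' + 1) → InFemtoWindow lam β' L' → luscherLambda β (L' + 1) = luscherLambda β' L' →
      ∀ Ω : GaugeConfig 3 (L' + 1) SU2 → ℝ, IsPhys Ω → (∀ U, 0 < Ω U) → l2 Ω Ω = 1 →
      (∀ U, ∫ V, transferKernel su2Rep β U V * Ω V ∂(configMeasure SU2 (L' + 1)) = topValue su2Rep (L' + 1) β * Ω U) →
      ∀ Ω' : GaugeConfig 3 L' SU2 → ℝ, IsPhys Ω' → ∀ c' : ℝ, 0 < c' → (∀ U', c' ≤ Ω' U') → l2 Ω' Ω' = 1 →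
      (∀ U', ∫ V', transferKernel su2Rep β' U' V' * Ω' V' ∂(configMeasure SU2 L') = topValue su2Rep L' β' * Ω' U') →
      ∀ φ' : GaugeConfig 3 L' SU2 → ℝ, IsPhys φ' →
        (∀ (v' : Site 3 L') (U' : GaugeConfig 3 L' SU2), φ' (fun e => U' (e.1 - v', e.2)) = φ' U') →
        l2 φ' Ω' = 0 → l2 φ' φ' = 1 →
        (∀ U', ∫ V', transferKernel su2Rep β' U' V' * φ' V' ∂(configMeasure SU2 L') = secondValue su2Rep L' β' * φ' U') →
        let T : GaugeConfig 3 (L' + 1) SU2 → GaugeConfig 3 L' SU2 := fun U e' =>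
          (List.ofFn fun t : Fin (if (e'.1 e'.2).val < L' + 1 - L' then 2 else 1) =>
            U ((fun j => (((e'.1 j).val + min (e'.1 j).val (L' + 1 - L') : ℕ) : ZMod (L' + 1))) +
              Pi.single e'.2 ((t : ℕ) : ZMod (L' + 1)), e'.2)).prod
        let fbar : GaugeConfig 3 (L' + 1) SU2 → ℝ := fun U =>
          (Fintype.card (Site 3 (L' + 1)) : ℝ)⁻¹ *
            ∑ v : Site 3 (L' + 1), φ' (T fun e => U (e.1 - v, e.2)) / Ω' (T fun e => U (e.1 - v, e.2))
        let ψ : GaugeConfig 3 (L' + 1) SU2 → ℝ := fun U => fbar U * Ω U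
        let K : (GaugeConfig 3 (L' + 1) SU2 → ℝ) → (GaugeConfig 3 (L' + 1) SU2 → ℝ) := fun χ U =>
          ∫ V, transferKernel su2Rep β U V * χ V ∂(configMeasure SU2 (L' + 1))
        secondValue su2Rep L' β' ^ L' * topValue su2Rep (L' + 1) β ^ (L' + 1) * (l2 ψ ψ - l2 ψ Ω ^ 2) ^ (L' + 1) ≤
          Real.exp (C * luscherLambda β (L' + 1) ^ 2 / (L' : ℝ)) *
            (topValue su2Rep L' β' ^ L' * (l2 ψ (K ψ) - topValue su2Rep (L' + 1) β * l2 ψ Ω ^ 2) ^ (L' + 1))) :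
    PinnedAutocorrExTI1 := by
  obtain ⟨lam1, hlam1, H1⟩ := hP1
  obtain ⟨C, lam2, hlam2, H2⟩ := hP2
  refine pinnedAutocorrExTI1_of_oneStep ⟨C, min lam1 lam2, lt_min hlam1 hlam2, fun lam hl hle => ?_⟩
  obtain ⟨L1, H1'⟩ := H1 lam hl (hle.trans (min_le_left _ _))
  obtain ⟨L2, H2'⟩ := H2 lam hl (hle.trans (min_le_right _ _))
  refine ⟨max L1 L2, ?_⟩
  intro L' _ hL0 β β' hw hw' hΛ Ω hΩ hpos hn hE Ω' hΩ' c' hc' hlow hn' hE'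
  have hβ' : 0 < β' := zero_lt_one.trans_le hw'.1
  have hpos' : ∀ U', 0 < Ω' U' := fun U' => hc'.trans_le (hlow U')
  obtain ⟨θ, hθ, hbd⟩ := H1' L' (le_of_max_le_left hL0) β' hw' Ω' hΩ' c' hc' hlow hn' hE'
  obtain ⟨φ', hφ', hTI, horth, hn1, hE1⟩ :=
    ZeroMomentum.exists_ti_secondEigen_of_zeroAvg_bound_inline hβ' hΩ' hpos' hn' hE' hθ hbd
  exact ⟨φ', hφ', hTI, horth, hn1, hE1,
    H2' L' (le_of_max_le_right hL0) β β' hw hw' hΛ Ω hΩ hpos hn hE Ω' hΩ' c' hc' hlow hn' hE' φ' hφ' hTI horth hn1 hE1⟩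

end Summit.QuantumFields.YangMills.Cruxes.PinnedUnitStepEx.TISplit1

end

/-! ## §3 (appended) The LOSSLESS split: (P1) as bare existence -/

noncomputable section

namespace Summit.QuantumFields.YangMills.Cruxes.PinnedUnitStepEx.TISplit1

open MeasureTheory
open Literature.MathematicalPhysics.QuantumFieldTheory (Site Edge GaugeConfig gaugeTransform)
open Summit.QuantumFields.YangMills.Theorems.FemtoTransferGap
open Summit.QuantumFields.YangMills.Theorems.FlatTubeReduction

/-- ★★ **SPLIT DOOR of stub 2, lossless form.**  `hP1` is (P1) itself — along the window, for the item's coarse ground state `Ω′`, THERE IS a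
translation-invariant normalised physical `φ′ ⊥ Ω′` with `K_{β′}φ′ = secondValue′·φ′` (kernel-integral spelling) — and `hP2` the one-step comparison
for EVERY such `φ′`; together they give `PinnedAutocorrExTI1` (`pinnedAutocorrExTI1_of_oneStep`).  The two earlier doors of this file feed `hP1`
through `ZeroMomentum.exists_ti_secondEigen_of_separation_inline` / `…_of_zeroAvg_bound_inline`; by the momentum dichotomy
`ZeroMomentum.exists_ti_secondEigen_or_zeroAvg_secondEigen`, `hP1` at `(L′, β′)` fails only if some purely zero-average normalised
`secondValue′`-eigenfunction `⊥ Ω′` exists.  Door only. [cite: ReedSimonIV1978, Thm. XIII.1] [cite: Luscher1983, §3] -/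
theorem pinnedAutocorrExTI1_of_exists_of_oneStep
    (hP1 : ∃ lam1 : ℝ, 0 < lam1 ∧ ∀ lam : ℝ, 0 < lam → lam ≤ lam1 → ∃ L1 : ℕ, ∀ (L' : ℕ) [NeZero L'], L1 ≤ L' → ∀ β' : ℝ,
      InFemtoWindow lam β' L' →
      ∀ Ω' : GaugeConfig 3 L' SU2 → ℝ, IsPhys Ω' → ∀ c' : ℝ, 0 < c' → (∀ U', c' ≤ Ω' U') → l2 Ω' Ω' = 1 →
      (∀ U', ∫ V', transferKernel su2Rep β' U' V' * Ω' V' ∂(configMeasure SU2 L') = topValue su2Rep L' β' * Ω' U') →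
      ∃ φ' : GaugeConfig 3 L' SU2 → ℝ, IsPhys φ' ∧
        (∀ (v' : Site 3 L') (U' : GaugeConfig 3 L' SU2), φ' (fun e => U' (e.1 - v', e.2)) = φ' U') ∧
        l2 φ' Ω' = 0 ∧ l2 φ' φ' = 1 ∧
        (∀ U', ∫ V', transferKernel su2Rep β' U' V' * φ' V' ∂(configMeasure SU2 L') = secondValue su2Rep L' β' * φ' U'))
    (hP2 : ∃ C lam2 : ℝ, 0 < lam2 ∧ ∀ lam : ℝ, 0 < lam → lam ≤ lam2 → ∃ L2 : ℕ, ∀ (L' : ℕ) [NeZero L'], L2 ≤ L' → ∀ β β' : ℝ,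
      InFemtoWindow lam β (L' + 1) → InFemtoWindow lam β' L' → luscherLambda β (L' + 1) = luscherLambda β' L' →
      ∀ Ω : GaugeConfig 3 (L' + 1) SU2 → ℝ, IsPhys Ω → (∀ U, 0 < Ω U) → l2 Ω Ω = 1 →
      (∀ U, ∫ V, transferKernel su2Rep β U V * Ω V ∂(configMeasure SU2 (L' + 1)) = topValue su2Rep (L' + 1) β * Ω U) →
      ∀ Ω' : GaugeConfig 3 L' SU2 → ℝ, IsPhys Ω' → ∀ c' : ℝ, 0 < c' → (∀ U', c' ≤ Ω' U') → l2 Ω' Ω' = 1 →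
      (∀ U', ∫ V', transferKernel su2Rep β' U' V' * Ω' V' ∂(configMeasure SU2 L') = topValue su2Rep L' β' * Ω' U') →
      ∀ φ' : GaugeConfig 3 L' SU2 → ℝ, IsPhys φ' →
        (∀ (v' : Site 3 L') (U' : GaugeConfig 3 L' SU2), φ' (fun e => U' (e.1 - v', e.2)) = φ' U') →
        l2 φ' Ω' = 0 → l2 φ' φ' = 1 →
        (∀ U', ∫ V', transferKernel su2Rep β' U' V' * φ' V' ∂(configMeasure SU2 L') = secondValue su2Rep L' β' * φ' U') →
        let T : GaugeConfig 3 (L' + 1) SU2 → GaugeConfig 3 L' SU2 := fun U e' =>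
          (List.ofFn fun t : Fin (if (e'.1 e'.2).val < L' + 1 - L' then 2 else 1) =>
            U ((fun j => (((e'.1 j).val + min (e'.1 j).val (L' + 1 - L') : ℕ) : ZMod (L' + 1))) +
              Pi.single e'.2 ((t : ℕ) : ZMod (L' + 1)), e'.2)).prod
        let fbar : GaugeConfig 3 (L' + 1) SU2 → ℝ := fun U =>
          (Fintype.card (Site 3 (L' + 1)) : ℝ)⁻¹ *
            ∑ v : Site 3 (L' + 1), φ' (T fun e => U (e.1 - v, e.2)) / Ω' (T fun e => U (e.1 - v, e.2))
        let ψ : GaugeConfig 3 (L' + 1) SU2 → ℝ := fun U => fbar U * Ω U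
        let K : (GaugeConfig 3 (L' + 1) SU2 → ℝ) → (GaugeConfig 3 (L' + 1) SU2 → ℝ) := fun χ U =>
          ∫ V, transferKernel su2Rep β U V * χ V ∂(configMeasure SU2 (L' + 1))
        secondValue su2Rep L' β' ^ L' * topValue su2Rep (L' + 1) β ^ (L' + 1) * (l2 ψ ψ - l2 ψ Ω ^ 2) ^ (L' + 1) ≤
          Real.exp (C * luscherLambda β (L' + 1) ^ 2 / (L' : ℝ)) *
            (topValue su2Rep L' β' ^ L' * (l2 ψ (K ψ) - topValue su2Rep (L' + 1) β * l2 ψ Ω ^ 2) ^ (L' + 1))) :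
    PinnedAutocorrExTI1 := by
  obtain ⟨lam1, hlam1, H1⟩ := hP1
  obtain ⟨C, lam2, hlam2, H2⟩ := hP2
  refine pinnedAutocorrExTI1_of_oneStep ⟨C, min lam1 lam2, lt_min hlam1 hlam2, fun lam hl hle => ?_⟩
  obtain ⟨L1, H1'⟩ := H1 lam hl (hle.trans (min_le_left _ _))
  obtain ⟨L2, H2'⟩ := H2 lam hl (hle.trans (min_le_right _ _))
  refine ⟨max L1 L2, ?_⟩
  intro L' _ hL0 β β' hw hw' hΛ Ω hΩ hpos hn hE Ω' hΩ' c' hc' hlow hn' hE'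
  obtain ⟨φ', hφ', hTI, horth, hn1, hE1⟩ := H1' L' (le_of_max_le_left hL0) β' hw' Ω' hΩ' c' hc' hlow hn' hE'
  exact ⟨φ', hφ', hTI, horth, hn1, hE1,
    H2' L' (le_of_max_le_right hL0) β β' hw hw' hΛ Ω hΩ hpos hn hE Ω' hΩ' c' hc' hlow hn' hE' φ' hφ' hTI horth hn1 hE1⟩

end Summit.QuantumFields.YangMills.Cruxes.PinnedUnitStepEx.TISplit1

end
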